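import Summits.Ventures.Crystal3D.Theorems.StickyWulffConstantNoReconstructionGainGrainFrameSplC
import HarnessLib

/-!
# The three-contact cap budget, first regime (pure real arithmetic)

HONEST FRAMING. Part of the venture `Summits/Ventures/Crystal3D` (cell `crystal3d-full`), helper
`--supports` the crux `NoReconstructionGain` (stmt-Ventures-19144, route
`route-Ventures-StickyWulffConstant`), line `adhesion` (wulff-p1 g12); a brick of the open stub
`stub_frameCapBudget` (skeleton v15), case of three substrate contacts.

Coordinates as in `…GrainFrameSplA` / `…GrainFrameCaps` / `…GrainFrameSplC`.  The CREDIT INTERFACE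
used by all `…GrainFrameThree*` files: the star directions are keyed by the integer coordinates
`(k, i, j)` of `Λ₀` (`i² + j² + k² + ij + ik + jk = 1`; cubic sign vector `(i+j, k+i, k+j)`), and two
abstract predicates `Cr`, `Lv` on `ℤ × ℤ × ℤ` are assumed to hold for a direction that is strictly down
and blocked-or-steep (`hCr`), resp. level and blocked (`hLv`); the conclusion `CREDITS` is: three
distinct `Cr`-directions, or two distinct `Cr`- and two distinct `Lv`-directions.  The assembling file
instantiates `Cr`, `Lv` with membership in the two filters of the stub.

* `weakA_pair_false`, `weakB_pair_false`, `weakE_pair_false`, `weakEAB_false` — the exclusions among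
  weak points of the first regime (`…GrainFrameSplC`): two contacts on the `d₁`-side (vertex `d₁` or
  edge cell `d₁d₆`), two on the `d₂`-side, or two in the edge cell `d₁d₂` overlap (`60°`-caps,
  `pair_cap` with `ecell_bound`); an edge-cell contact with one on each side forces the level pair
  `±d₆` to be blocked.
* `capBudget_three_regimeI` — **the budget for three contacts in the regime
  `max(a+b, c−a) < 2t ≤ a+c`**: `d₁, d₂` are steep; a third strictly-down blocked direction, or the two
  level half-credits `±d₆` (mirror plane `a = b`), or — by the classification and the exclusions — a
  contradiction.

WHAT THIS IS NOT: the regime `2t > a+c` (next files); rung F-C1 not moved.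
-/

namespace Summit.Ventures.Crystal3D.Theorems

/-! ## Exclusions among weak points -/

/-- Two contacts on the `d₁`-side (each the vertex `d₁` or in the edge cell `d₁d₆`) overlap. -/
theorem weakA_pair_false {x y z x' y' z' : ℝ} (hu : x ^ 2 + y ^ 2 + z ^ 2 = 2)
    (hu' : x' ^ 2 + y' ^ 2 + z' ^ 2 = 2) (hsep : x * x' + y * y' + z * z' ≤ 1)
    (hA : (x = 0 ∧ y = 1 ∧ z = 1) ∨ (1 < y + z ∧ 1 < y - x ∧ y - z ≤ 1 ∧ x + y ≤ 1 ∧ z - x ≤ 1))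
    (hA' : (x' = 0 ∧ y' = 1 ∧ z' = 1) ∨ (1 < y' + z' ∧ 1 < y' - x' ∧ y' - z' ≤ 1 ∧ x' + y' ≤ 1 ∧ z' - x' ≤ 1)) :
    False := by
  have hB : 1 < y + z := by rcases hA with ⟨-, h2, h3⟩ | ⟨h, -⟩ <;> linarith
  have hB' : 1 < y' + z' := by rcases hA' with ⟨-, h2, h3⟩ | ⟨h, -⟩ <;> linarith
  rcases hA with ⟨h1, h2, h3⟩ | ⟨h1, h2, h3, h4, h5⟩
  · subst h1; subst h2; subst h3; linarith
  rcases hA' with ⟨h1', h2', h3'⟩ | ⟨h1', h2', h3', h4', h5'⟩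
  · subst h1'; subst h2'; subst h3'; linarith
  -- two points of the edge cell `d₁d₆`: coordinates `(z, −x, y)`
  obtain ⟨e, -⟩ := ecell_bound (p := z) (q := -x) (r := y) (by linarith) (by linarith) (by linarith)
    (by linarith) (by linarith) (by linarith)
  obtain ⟨e', -⟩ := ecell_bound (p := z') (q := -x') (r := y') (by linarith) (by linarith) (by linarith)
    (by linarith) (by linarith) (by linarith)
  have hs : 6 < ((-1) * x + 2 * y + 1 * z) + ((-1) * x' + 2 * y' + 1 * z') := by linarith
  exact pair_cap (m₁ := -1) (m₂ := 2) (m₃ := 1) hu hu' hsep (by nlinarith)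

/-- Two contacts on the `d₂`-side (each the vertex `d₂` or in the edge cell `d₂(−d₆)`) overlap. -/
theorem weakB_pair_false {x y z x' y' z' : ℝ} (hu : x ^ 2 + y ^ 2 + z ^ 2 = 2)
    (hu' : x' ^ 2 + y' ^ 2 + z' ^ 2 = 2) (hsep : x * x' + y * y' + z * z' ≤ 1)
    (hB : (x = 1 ∧ y = 0 ∧ z = 1) ∨ (1 < x + z ∧ 1 < x - y ∧ x - z ≤ 1 ∧ x + y ≤ 1 ∧ z - y ≤ 1))
    (hB' : (x' = 1 ∧ y' = 0 ∧ z' = 1) ∨ (1 < x' + z' ∧ 1 < x' - y' ∧ x' - z' ≤ 1 ∧ x' + y' ≤ 1 ∧ z' - y' ≤ 1)) :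
    False := by
  have hu2 : y ^ 2 + x ^ 2 + z ^ 2 = 2 := by linarith
  have hu2' : y' ^ 2 + x' ^ 2 + z' ^ 2 = 2 := by linarith
  refine weakA_pair_false hu2 hu2' (by linarith) ?_ ?_
  · rcases hB with ⟨h1, h2, h3⟩ | ⟨h1, h2, h3, h4, h5⟩
    · exact Or.inl ⟨h2, h1, h3⟩
    · exact Or.inr ⟨by linarith, by linarith, h3, by linarith, h5⟩
  · rcases hB' with ⟨h1, h2, h3⟩ | ⟨h1, h2, h3, h4, h5⟩
    · exact Or.inl ⟨h2, h1, h3⟩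
    · exact Or.inr ⟨by linarith, by linarith, h3, by linarith, h5⟩

/-- Two contacts in the edge cell `d₁d₂` overlap. -/
theorem weakE_pair_false {x y z x' y' z' : ℝ} (hu : x ^ 2 + y ^ 2 + z ^ 2 = 2)
    (hu' : x' ^ 2 + y' ^ 2 + z' ^ 2 = 2) (hsep : x * x' + y * y' + z * z' ≤ 1)
    (hE : 1 < y + z ∧ 1 < x + z ∧ x + y ≤ 1 ∧ z - x ≤ 1 ∧ z - y ≤ 1)
    (hE' : 1 < y' + z' ∧ 1 < x' + z' ∧ x' + y' ≤ 1 ∧ z' - x' ≤ 1 ∧ z' - y' ≤ 1) : False := by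
  obtain ⟨h1, h2, h3, h4, h5⟩ := hE
  obtain ⟨h1', h2', h3', h4', h5'⟩ := hE'
  obtain ⟨e, -⟩ := ecell_bound hu h1 h2 h3 h4 h5
  obtain ⟨e', -⟩ := ecell_bound hu' h1' h2' h3' h4' h5'
  have hs : 6 < (1 * x + 1 * y + 2 * z) + (1 * x' + 1 * y' + 2 * z') := by linarith
  exact pair_cap (m₁ := 1) (m₂ := 1) (m₃ := 2) hu hu' hsep (by nlinarith)

/-- An edge-cell contact, a `d₁`-side contact and a `d₂`-side contact force the two edge cells
`d₁d₆` (mirror plane) and `d₂(−d₆)`. -/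
theorem weakEAB_imp {a b x y z x' y' z' x'' y'' z'' : ℝ}
    (hsep : x * x' + y * y' + z * z' ≤ 1) (hsep' : x * x'' + y * y'' + z * z'' ≤ 1)
    (hE : 1 < y + z ∧ 1 < x + z ∧ x + y ≤ 1 ∧ z - x ≤ 1 ∧ z - y ≤ 1)
    (hA : (x' = 0 ∧ y' = 1 ∧ z' = 1) ∨
      (a = b ∧ 1 < y' + z' ∧ 1 < y' - x' ∧ y' - z' ≤ 1 ∧ x' + y' ≤ 1 ∧ z' - x' ≤ 1))
    (hB : (x'' = 1 ∧ y'' = 0 ∧ z'' = 1) ∨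
      (1 < x'' + z'' ∧ 1 < x'' - y'' ∧ x'' - z'' ≤ 1 ∧ x'' + y'' ≤ 1 ∧ z'' - y'' ≤ 1)) :
    a = b ∧ 1 < y' - x' ∧ 1 < x'' - y'' := by
  obtain ⟨h1, h2, -⟩ := hE
  rcases hA with ⟨e1, e2, e3⟩ | ⟨hab, -, hA2, -⟩
  · subst e1; subst e2; subst e3; linarith
  rcases hB with ⟨e1, e2, e3⟩ | ⟨-, hB2, -⟩
  · subst e1; subst e2; subst e3; linarith
  exact ⟨hab, hA2, hB2⟩

/-! ## The first regime -/

section core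
variable {a b c T x₁ y₁ z₁ x₂ y₂ z₂ x₃ y₃ z₃ : ℝ} {Cr Lv : ℤ × ℤ × ℤ → Prop}
  (ha : 0 ≤ a) (hab : a ≤ b) (hbc : b ≤ c) (hS : a ^ 2 + b ^ 2 + c ^ 2 = 2)
  (hu₁ : x₁ ^ 2 + y₁ ^ 2 + z₁ ^ 2 = 2) (hu₂ : x₂ ^ 2 + y₂ ^ 2 + z₂ ^ 2 = 2)
  (hu₃ : x₃ ^ 2 + y₃ ^ 2 + z₃ ^ 2 = 2)
  (h12 : x₁ * x₂ + y₁ * y₂ + z₁ * z₂ ≤ 1) (h13 : x₁ * x₃ + y₁ * y₃ + z₁ * z₃ ≤ 1)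
  (h23 : x₂ * x₃ + y₂ * y₃ + z₂ * z₃ ≤ 1)
  (hT3 : a + b < T) (hT4 : c - a < T)
  (hδ₁ : T ≤ a * x₁ + b * y₁ + c * z₁) (hδ₂ : T ≤ a * x₂ + b * y₂ + c * z₂)
  (hδ₃ : T ≤ a * x₃ + b * y₃ + c * z₃)
  (hCr : ∀ (k i j : ℤ) (e₁ e₂ e₃ : ℝ), e₁ = i + j → e₂ = k + i → e₃ = k + j →
    i ^ 2 + j ^ 2 + k ^ 2 + i * j + i * k + j * k = 1 → 0 < e₁ * a + e₂ * b + e₃ * c →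
    (1 < e₁ * x₁ + e₂ * y₁ + e₃ * z₁ ∨ 1 < e₁ * x₂ + e₂ * y₂ + e₃ * z₂ ∨ 1 < e₁ * x₃ + e₂ * y₃ + e₃ * z₃ ∨
      T ≤ e₁ * a + e₂ * b + e₃ * c) → Cr (k, i, j))
  (hLv : ∀ (k i j : ℤ) (e₁ e₂ e₃ : ℝ), e₁ = i + j → e₂ = k + i → e₃ = k + j →
    i ^ 2 + j ^ 2 + k ^ 2 + i * j + i * k + j * k = 1 → e₁ * a + e₂ * b + e₃ * c = 0 →
    (1 < e₁ * x₁ + e₂ * y₁ + e₃ * z₁ ∨ 1 < e₁ * x₂ + e₂ * y₂ + e₃ * z₂ ∨ 1 < e₁ * x₃ + e₂ * y₃ + e₃ * z₃) →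
    Lv (k, i, j))
include ha hab hbc hS hu₁ hu₂ hu₃ h12 h13 h23 hT3 hT4 hδ₁ hδ₂ hδ₃ hCr hLv

omit ha hbc in
set_option maxHeartbeats 800000 in
/-- **The three-contact cap budget in the first regime `max(a+b, c−a) < 2t ≤ a+c`.** -/
theorem capBudget_three_regimeI (hTI : T ≤ a + c) :
    (∃ q₁ q₂ q₃ : ℤ × ℤ × ℤ, q₁ ≠ q₂ ∧ q₁ ≠ q₃ ∧ q₂ ≠ q₃ ∧ Cr q₁ ∧ Cr q₂ ∧ Cr q₃) ∨
    (∃ q₁ q₂ l₁ l₂ : ℤ × ℤ × ℤ, q₁ ≠ q₂ ∧ l₁ ≠ l₂ ∧ Cr q₁ ∧ Cr q₂ ∧ Lv l₁ ∧ Lv l₂) := by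
  have ha0 : 0 < a := by linarith
  have hbc' : b < c := by linarith
  have hc : 0 < c := by linarith
  -- credit wrappers for `d₁ … d₆`
  have cD1 := hCr 1 0 0 0 1 1 (by norm_num) (by norm_num) (by norm_num) (by norm_num) (by linarith)
  have cD2 := hCr 0 0 1 1 0 1 (by norm_num) (by norm_num) (by norm_num) (by norm_num) (by linarith)
  have cD3 := hCr 0 1 0 1 1 0 (by norm_num) (by norm_num) (by norm_num) (by norm_num) (by linarith)
  have cD4 := hCr 1 (-1) 0 (-1) 0 1 (by norm_num) (by norm_num) (by norm_num) (by norm_num) (by linarith)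
  have cD5 := hCr 0 (-1) 1 0 (-1) 1 (by norm_num) (by norm_num) (by norm_num) (by norm_num) (by linarith)
  have C1 : Cr (1, 0, 0) := cD1 (Or.inr (Or.inr (Or.inr (by linarith))))
  have C2 : Cr (0, 0, 1) := cD2 (Or.inr (Or.inr (Or.inr (by linarith))))
  have ne12 : ((1 : ℤ), (0 : ℤ), (0 : ℤ)) ≠ (0, 0, 1) := by decide
  -- a third strictly-down blocked direction closes the budget
  have third : ∀ q : ℤ × ℤ × ℤ, q ≠ (1, 0, 0) → q ≠ (0, 0, 1) → Cr q →
      (∃ q₁ q₂ q₃ : ℤ × ℤ × ℤ, q₁ ≠ q₂ ∧ q₁ ≠ q₃ ∧ q₂ ≠ q₃ ∧ Cr q₁ ∧ Cr q₂ ∧ Cr q₃) ∨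
      (∃ q₁ q₂ l₁ l₂ : ℤ × ℤ × ℤ, q₁ ≠ q₂ ∧ l₁ ≠ l₂ ∧ Cr q₁ ∧ Cr q₂ ∧ Lv l₁ ∧ Lv l₂) :=
    fun q h1 h2 hq => Or.inl ⟨(1, 0, 0), (0, 0, 1), q, ne12, fun h => h1 h.symm, fun h => h2 h.symm, C1, C2, hq⟩
  by_cases b31 : 1 < x₁ + y₁
  · exact third (0, 1, 0) (by decide) (by decide) (cD3 (Or.inl (by linarith)))
  by_cases b32 : 1 < x₂ + y₂
  · exact third (0, 1, 0) (by decide) (by decide) (cD3 (Or.inr (Or.inl (by linarith))))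
  by_cases b33 : 1 < x₃ + y₃
  · exact third (0, 1, 0) (by decide) (by decide) (cD3 (Or.inr (Or.inr (Or.inl (by linarith)))))
  by_cases b41 : 1 < z₁ - x₁
  · exact third (1, -1, 0) (by decide) (by decide) (cD4 (Or.inl (by linarith)))
  by_cases b42 : 1 < z₂ - x₂
  · exact third (1, -1, 0) (by decide) (by decide) (cD4 (Or.inr (Or.inl (by linarith))))
  by_cases b43 : 1 < z₃ - x₃
  · exact third (1, -1, 0) (by decide) (by decide) (cD4 (Or.inr (Or.inr (Or.inl (by linarith)))))
  by_cases b51 : 1 < z₁ - y₁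
  · exact third (0, -1, 1) (by decide) (by decide) (cD5 (Or.inl (by linarith)))
  by_cases b52 : 1 < z₂ - y₂
  · exact third (0, -1, 1) (by decide) (by decide) (cD5 (Or.inr (Or.inl (by linarith))))
  by_cases b53 : 1 < z₃ - y₃
  · exact third (0, -1, 1) (by decide) (by decide) (cD5 (Or.inr (Or.inr (Or.inl (by linarith)))))
  by_cases b61 : a < b ∧ 1 < y₁ - x₁
  · exact third (1, 0, -1) (by decide) (by decide) (hCr 1 0 (-1) (-1) 1 0 (by norm_num) (by norm_num)
      (by norm_num) (by norm_num) (by linarith [b61.1]) (Or.inl (by linarith [b61.2])))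
  by_cases b62 : a < b ∧ 1 < y₂ - x₂
  · exact third (1, 0, -1) (by decide) (by decide) (hCr 1 0 (-1) (-1) 1 0 (by norm_num) (by norm_num)
      (by norm_num) (by norm_num) (by linarith [b62.1]) (Or.inr (Or.inl (by linarith [b62.2]))))
  by_cases b63 : a < b ∧ 1 < y₃ - x₃
  · exact third (1, 0, -1) (by decide) (by decide) (hCr 1 0 (-1) (-1) 1 0 (by norm_num) (by norm_num)
      (by norm_num) (by norm_num) (by linarith [b63.1]) (Or.inr (Or.inr (Or.inl (by linarith [b63.2])))))
  push Not at b31 b32 b33 b41 b42 b43 b51 b52 b53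
  have n61 : a < b → y₁ - x₁ ≤ 1 := fun h => le_of_not_gt fun h' => b61 ⟨h, h'⟩
  have n62 : a < b → y₂ - x₂ ≤ 1 := fun h => le_of_not_gt fun h' => b62 ⟨h, h'⟩
  have n63 : a < b → y₃ - x₃ ≤ 1 := fun h => le_of_not_gt fun h' => b63 ⟨h, h'⟩
  -- the two level half-credits `±d₆` on the mirror plane
  by_cases hlev : a = b ∧ (1 < y₁ - x₁ ∨ 1 < y₂ - x₂ ∨ 1 < y₃ - x₃) ∧ (1 < x₁ - y₁ ∨ 1 < x₂ - y₂ ∨ 1 < x₃ - y₃)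
  · obtain ⟨hab', hl, hl'⟩ := hlev
    refine Or.inr ⟨(1, 0, 0), (0, 0, 1), (1, 0, -1), (-1, 0, 1), ne12, by decide, C1, C2, ?_, ?_⟩
    · refine hLv 1 0 (-1) (-1) 1 0 (by norm_num) (by norm_num) (by norm_num) (by norm_num) (by linarith) ?_
      rcases hl with h | h | h
      · exact Or.inl (by linarith)
      · exact Or.inr (Or.inl (by linarith))
      · exact Or.inr (Or.inr (by linarith))
    · refine hLv (-1) 0 1 1 (-1) 0 (by norm_num) (by norm_num) (by norm_num) (by norm_num) (by linarith) ?_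
      rcases hl' with h | h | h
      · exact Or.inl (by linarith)
      · exact Or.inr (Or.inl (by linarith))
      · exact Or.inr (Or.inr (by linarith))
  exfalso
  -- classification of the three weak contacts
  have W₁ := weakI_coords ha0 hab hbc' hS hu₁ (by linarith) (by linarith) b31 b41 b51 n61
  have W₂ := weakI_coords ha0 hab hbc' hS hu₂ (by linarith) (by linarith) b32 b42 b52 n62
  have W₃ := weakI_coords ha0 hab hbc' hS hu₃ (by linarith) (by linarith) b33 b43 b53 n63
  -- regroup: `d₁`-side (A) / `d₂`-side (B) / edge cell (E), carrying the non-blocking facts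
  have K : ∀ {x y z : ℝ}, x + y ≤ 1 → z - x ≤ 1 → z - y ≤ 1 →
      ((x = 0 ∧ y = 1 ∧ z = 1) ∨ (x = 1 ∧ y = 0 ∧ z = 1) ∨ (1 < y + z ∧ 1 < x + z) ∨
        (1 < x + z ∧ 1 < x - y ∧ x - z ≤ 1 ∧ y + z ≤ 1) ∨
        (a = b ∧ 1 < y + z ∧ 1 < y - x ∧ y - z ≤ 1 ∧ x + z ≤ 1)) →
      ((x = 0 ∧ y = 1 ∧ z = 1) ∨ (a = b ∧ 1 < y + z ∧ 1 < y - x ∧ y - z ≤ 1 ∧ x + y ≤ 1 ∧ z - x ≤ 1)) ∨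
      ((x = 1 ∧ y = 0 ∧ z = 1) ∨ (1 < x + z ∧ 1 < x - y ∧ x - z ≤ 1 ∧ x + y ≤ 1 ∧ z - y ≤ 1)) ∨
      (1 < y + z ∧ 1 < x + z ∧ x + y ≤ 1 ∧ z - x ≤ 1 ∧ z - y ≤ 1) := by
    intro x y z n3 n4 n5 W
    rcases W with h | h | ⟨h1, h2⟩ | ⟨h1, h2, h3, -⟩ | ⟨h0, h1, h2, h3, -⟩
    · exact Or.inl (Or.inl h)
    · exact Or.inr (Or.inl (Or.inl h))
    · exact Or.inr (Or.inr ⟨h1, h2, n3, n4, n5⟩)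
    · exact Or.inr (Or.inl (Or.inr ⟨h1, h2, h3, n3, n5⟩))
    · exact Or.inl (Or.inr ⟨h0, h1, h2, h3, n3, n4⟩)
  have dropA : ∀ {x y z : ℝ},
      ((x = 0 ∧ y = 1 ∧ z = 1) ∨ (a = b ∧ 1 < y + z ∧ 1 < y - x ∧ y - z ≤ 1 ∧ x + y ≤ 1 ∧ z - x ≤ 1)) →
      ((x = 0 ∧ y = 1 ∧ z = 1) ∨ (1 < y + z ∧ 1 < y - x ∧ y - z ≤ 1 ∧ x + y ≤ 1 ∧ z - x ≤ 1)) :=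
    fun h => h.imp id fun h' => h'.2
  have K₁ := K b31 b41 b51 W₁
  have K₂ := K b32 b42 b52 W₂
  have K₃ := K b33 b43 b53 W₃
  have h21 : x₂ * x₁ + y₂ * y₁ + z₂ * z₁ ≤ 1 := by linarith
  have h31 : x₃ * x₁ + y₃ * y₁ + z₃ * z₁ ≤ 1 := by linarith
  have h32 : x₃ * x₂ + y₃ * y₂ + z₃ * z₂ ≤ 1 := by linarith
  rcases K₁ with A1 | B1 | E1 <;> rcases K₂ with A2 | B2 | E2 <;> rcases K₃ with A3 | B3 | E3
  · exact weakA_pair_false hu₁ hu₂ h12 (dropA A1) (dropA A2)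
  · exact weakA_pair_false hu₁ hu₂ h12 (dropA A1) (dropA A2)
  · exact weakA_pair_false hu₁ hu₂ h12 (dropA A1) (dropA A2)
  · exact weakA_pair_false hu₁ hu₃ h13 (dropA A1) (dropA A3)
  · exact weakB_pair_false hu₂ hu₃ h23 B2 B3
  · obtain ⟨h0, h1, h2⟩ := weakEAB_imp h31 h32 E3 A1 B2
    exact hlev ⟨h0, Or.inl h1, Or.inr (Or.inl h2)⟩
  · exact weakA_pair_false hu₁ hu₃ h13 (dropA A1) (dropA A3)
  · obtain ⟨h0, h1, h2⟩ := weakEAB_imp h21 h23 E2 A1 B3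
    exact hlev ⟨h0, Or.inl h1, Or.inr (Or.inr h2)⟩
  · exact weakE_pair_false hu₂ hu₃ h23 E2 E3
  · exact weakA_pair_false hu₂ hu₃ h23 (dropA A2) (dropA A3)
  · exact weakB_pair_false hu₁ hu₃ h13 B1 B3
  · obtain ⟨h0, h1, h2⟩ := weakEAB_imp h32 h31 E3 A2 B1
    exact hlev ⟨h0, Or.inr (Or.inl h1), Or.inl h2⟩
  · exact weakB_pair_false hu₁ hu₂ h12 B1 B2
  · exact weakB_pair_false hu₁ hu₂ h12 B1 B2
  · exact weakB_pair_false hu₁ hu₂ h12 B1 B2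
  · obtain ⟨h0, h1, h2⟩ := weakEAB_imp h23 h21 E2 A3 B1
    exact hlev ⟨h0, Or.inr (Or.inr h1), Or.inl h2⟩
  · exact weakB_pair_false hu₁ hu₃ h13 B1 B3
  · exact weakE_pair_false hu₂ hu₃ h23 E2 E3
  · exact weakA_pair_false hu₂ hu₃ h23 (dropA A2) (dropA A3)
  · obtain ⟨h0, h1, h2⟩ := weakEAB_imp h12 h13 E1 A2 B3
    exact hlev ⟨h0, Or.inr (Or.inl h1), Or.inr (Or.inr h2)⟩
  · exact weakE_pair_false hu₁ hu₃ h13 E1 E3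
  · obtain ⟨h0, h1, h2⟩ := weakEAB_imp h13 h12 E1 A3 B2
    exact hlev ⟨h0, Or.inr (Or.inr h1), Or.inr (Or.inl h2)⟩
  · exact weakB_pair_false hu₂ hu₃ h23 B2 B3
  · exact weakE_pair_false hu₁ hu₃ h13 E1 E3
  · exact weakE_pair_false hu₁ hu₂ h12 E1 E2
  · exact weakE_pair_false hu₁ hu₂ h12 E1 E2
  · exact weakE_pair_false hu₁ hu₂ h12 E1 E2

end core

end Summit.Ventures.Crystal3D.Theorems
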